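import Summits.Ventures.PercRepro.C025ProfileRankFourLemmas

/-!
# THE ROW (2,3) IN EVERY RANK — the closed-form local certificate `wg`, its evaluations and bounds, the double count
(night-3 g8)

`proofs/NIGHT3-G8-GENERAL-CERTIFICATE.md` §0: the rank-4 rule `w4` of NIGHT3-G7-RANK4-CERTIFICATE.md lifted to every
rank (the LP-forced entries at ranks 5 and 6 read off as closed forms in `p = ρ(E∖B)` and `r = ρ(E∖S)`):
  `e = 1`: `|B| ≥ 3 ↦ p/(r+1−j)`; `|B| = 2 ↦ p/(r+1)` (`j = 0`), `1` (`j = 1`), `(p+2)/p` if `r = p−1` else `1` (`j = 2`);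
  `e = 2, |B| = 2`: `j = 1 ∧ r = p−2 ↦ 1/(p−1)`; `j = 2 ∧ p ≥ 4 ↦ 2/(p(p−2))` (`r = p−2`), `1/(2(p−1))` (`r = p−1`),
  `1/(3(p−1))` (`r = p`); all else `0`; `0` when `p < 3`.
`wgn := max 0 wg` is the nonnegative form used throughout. This module: the definition, the evaluation of `wgn` on the
three paying shapes, the vanishing cases, the upper bounds for pairs with two extra points (`≤ 1/2`; `≤ 1/3` at
`r = 2`; `≤ 1/4` at `r ≥ 3`; `≤ 1/6` at `r ≥ 3` when `j = 2` or `p ≤ r+1`; `≤ 1/(2r)` and `≤ 1/(3(r−1))` in the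
tight shapes of (Cap)(c)), and the double count **`profileIneq_two_three_of_certG`**: (Cap) ∧ (Dem) for `wgn` on `M`
give `(Π_{2,3})` on `M`.
-/

open scoped Matroid

namespace PercRepro

open Set Finset ThmH

section GenRule

variable {α : Type} [DecidableEq α] (M : Matroid α) [M.Finite]

/-- **The general-rank certificate** for the row `(2,3)` (NIGHT3-G8-GENERAL-CERTIFICATE.md §0). -/
noncomputable def wg (B S : Finset α) : ℚ :=
  let p := crk M B
  let r := crk M S
  let j := jB M B
  let e := (S \ B).card
  if p < 3 then 0
  else if e = 1 then
    (if 3 ≤ B.card then (p : ℚ) / ((r : ℚ) + 1 - (j : ℚ))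
     else if j = 0 then (p : ℚ) / ((r : ℚ) + 1)
     else if j = 1 then 1
     else if r + 1 = p then ((p : ℚ) + 2) / (p : ℚ) else 1)
  else if e = 2 ∧ B.card = 2 then
    (if j = 1 ∧ r + 2 = p then 1 / ((p : ℚ) - 1)
     else if j = 2 ∧ 4 ≤ p then
       (if r + 2 = p then 2 / ((p : ℚ) * ((p : ℚ) - 2))
        else if r + 1 = p then 1 / (2 * ((p : ℚ) - 1))
        else if r = p then 1 / (3 * ((p : ℚ) - 1)) else 0)
     else 0)
  else 0

/-- The nonnegative form of the general certificate. -/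
noncomputable def wgn (B S : Finset α) : ℚ := max 0 (wg M B S)

variable {M}

/-- `wgn ≥ 0`. -/
theorem wgn_nonneg (B S : Finset α) : 0 ≤ wgn M B S := le_max_left _ _

/-- The rule on a set with one extra point over a rank-`2` set with at least three points. -/
theorem wg_of_sdiff_card_one_of_three_le_card {B S : Finset α} (he : (S \ B).card = 1) (hB3 : 3 ≤ B.card)
    (hp : 3 ≤ crk M B) : wg M B S = (crk M B : ℚ) / ((crk M S : ℚ) + 1 - (jB M B : ℚ)) := by
  unfold wg
  simp only
  rw [if_neg (by omega : ¬ crk M B < 3), if_pos he, if_pos hB3]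

/-- The rule on a set with one extra point over a pair. -/
theorem wg_of_sdiff_card_one_of_card_two {B S : Finset α} (he : (S \ B).card = 1) (hB2 : B.card = 2)
    (hp : 3 ≤ crk M B) : wg M B S =
      (if jB M B = 0 then (crk M B : ℚ) / ((crk M S : ℚ) + 1)
       else if jB M B = 1 then 1
       else if crk M S + 1 = crk M B then ((crk M B : ℚ) + 2) / (crk M B : ℚ) else 1) := by
  unfold wg
  simp only
  rw [if_neg (by omega : ¬ crk M B < 3), if_pos he, if_neg (by omega : ¬ 3 ≤ B.card)]

/-- The rule on a set with two extra points over a pair. -/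
theorem wg_of_sdiff_card_two_of_card_two {B S : Finset α} (he : (S \ B).card = 2) (hB2 : B.card = 2)
    (hp : 3 ≤ crk M B) : wg M B S =
      (if jB M B = 1 ∧ crk M S + 2 = crk M B then 1 / ((crk M B : ℚ) - 1)
       else if jB M B = 2 ∧ 4 ≤ crk M B then
         (if crk M S + 2 = crk M B then 2 / ((crk M B : ℚ) * ((crk M B : ℚ) - 2))
          else if crk M S + 1 = crk M B then 1 / (2 * ((crk M B : ℚ) - 1))
          else if crk M S = crk M B then 1 / (3 * ((crk M B : ℚ) - 1)) else 0)
       else 0) := by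
  unfold wg
  simp only
  rw [if_neg (by omega : ¬ crk M B < 3), if_neg (by omega : ¬ (S \ B).card = 1), if_pos ⟨he, hB2⟩]

/-- Nothing is paid to a set whose complement has rank `< 3`. -/
theorem wgn_eq_zero_of_crk_lt_three {B S : Finset α} (hp : crk M B < 3) : wgn M B S = 0 := by
  unfold wgn wg
  simp only
  rw [if_pos hp, max_self]

/-- Nothing is paid to a set with three or more extra points. -/
theorem wgn_eq_zero_of_three_le_sdiff_card {B S : Finset α} (h : 3 ≤ (S \ B).card) : wgn M B S = 0 := by
  unfold wgn wg
  simp only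
  have h1 : (S \ B).card ≠ 1 := by omega
  have h2 : ¬ ((S \ B).card = 2 ∧ B.card = 2) := by omega
  split_ifs <;> simp

/-- A set with exactly two extra points over a rank-`2` set that is not a pair is paid nothing. -/
theorem wgn_eq_zero_of_sdiff_card_two_of_card_ne_two {B S : Finset α} (he : (S \ B).card = 2) (hB : B.card ≠ 2) :
    wgn M B S = 0 := by
  unfold wgn wg
  simp only
  have h1 : (S \ B).card ≠ 1 := by omega
  have h2 : ¬ ((S \ B).card = 2 ∧ B.card = 2) := fun h => hB h.2
  split_ifs <;> simp

/-- Arithmetic: `1/(p−1) ≤ 1/2` for `p ≥ 3`. -/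
theorem inv_sub_one_le_half {p : ℚ} (hp : 3 ≤ p) : 1 / (p - 1) ≤ 1 / 2 := by
  rw [div_le_div_iff₀ (by linarith) (by norm_num)]; linarith

/-- Arithmetic: `1/(p−1) ≤ 1/4` for `p ≥ 5`. -/
theorem inv_sub_one_le_quarter {p : ℚ} (hp : 5 ≤ p) : 1 / (p - 1) ≤ 1 / 4 := by
  rw [div_le_div_iff₀ (by linarith) (by norm_num)]; linarith

/-- Arithmetic: `2/(p(p−2)) ≤ 1/4` for `p ≥ 4`. -/
theorem two_div_le_quarter {p : ℚ} (hp : 4 ≤ p) : 2 / (p * (p - 2)) ≤ 1 / 4 := by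
  have : (0 : ℚ) < p * (p - 2) := by nlinarith
  rw [div_le_div_iff₀ this (by norm_num)]; nlinarith

/-- Arithmetic: `2/(p(p−2)) ≤ 1/6` for `p ≥ 5`. -/
theorem two_div_le_sixth {p : ℚ} (hp : 5 ≤ p) : 2 / (p * (p - 2)) ≤ 1 / 6 := by
  have : (0 : ℚ) < p * (p - 2) := by nlinarith
  rw [div_le_div_iff₀ this (by norm_num)]; nlinarith

/-- Arithmetic: `1/(2(p−1)) ≤ 1/6` for `p ≥ 4`. -/
theorem inv_two_sub_le_sixth {p : ℚ} (hp : 4 ≤ p) : 1 / (2 * (p - 1)) ≤ 1 / 6 := by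
  rw [div_le_div_iff₀ (by linarith) (by norm_num)]; linarith

/-- Arithmetic: `1/(3(p−1)) ≤ 1/6` for `p ≥ 3`. -/
theorem inv_three_sub_le_sixth {p : ℚ} (hp : 3 ≤ p) : 1 / (3 * (p - 1)) ≤ 1 / 6 := by
  rw [div_le_div_iff₀ (by linarith) (by norm_num)]; linarith

/-- A pair with two extra points is paid at most `1/2`. -/
theorem wgn_le_half_of_sdiff_card_two {B S : Finset α} (he : (S \ B).card = 2) (hB2 : B.card = 2) :
    wgn M B S ≤ 1 / 2 := by
  by_cases hp3 : crk M B < 3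
  · rw [wgn_eq_zero_of_crk_lt_three hp3]; norm_num
  push Not at hp3
  unfold wgn
  rw [wg_of_sdiff_card_two_of_card_two he hB2 hp3]
  apply max_le (by norm_num)
  have hp3q : (3 : ℚ) ≤ (crk M B : ℚ) := by exact_mod_cast hp3
  split_ifs with h1 h2 h3 h4 h5
  · exact inv_sub_one_le_half hp3q
  · have hp4 : (4 : ℚ) ≤ (crk M B : ℚ) := by exact_mod_cast h2.2
    exact (two_div_le_quarter hp4).trans (by norm_num)
  · have hp4 : (4 : ℚ) ≤ (crk M B : ℚ) := by exact_mod_cast h2.2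
    exact (inv_two_sub_le_sixth hp4).trans (by norm_num)
  · exact (inv_three_sub_le_sixth hp3q).trans (by norm_num)
  · norm_num
  · norm_num

/-- A pair with two extra points on a two-point line (`j = 0`) is paid nothing. -/
theorem wgn_eq_zero_of_sdiff_card_two_of_jB_eq_zero {B S : Finset α} (he : (S \ B).card = 2) (hB2 : B.card = 2)
    (hj : jB M B = 0) : wgn M B S = 0 := by
  by_cases hp3 : crk M B < 3
  · exact wgn_eq_zero_of_crk_lt_three hp3
  push Not at hp3
  unfold wgn
  rw [wg_of_sdiff_card_two_of_card_two he hB2 hp3, if_neg (by rw [hj]; omega), if_neg (by rw [hj]; omega), max_self]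

/-- A pair with two extra points is paid at most `1/3` when `ρ(E∖S) = 2`. -/
theorem wgn_le_third_of_sdiff_card_two_of_crk_eq_two {B S : Finset α} (he : (S \ B).card = 2) (hB2 : B.card = 2)
    (hr : crk M S = 2) : wgn M B S ≤ 1 / 3 := by
  by_cases hp3 : crk M B < 3
  · rw [wgn_eq_zero_of_crk_lt_three hp3]; norm_num
  push Not at hp3
  unfold wgn
  rw [wg_of_sdiff_card_two_of_card_two he hB2 hp3, hr]
  apply max_le (by norm_num)
  split_ifs with h1 h2 h3 h4 h5
  · have : crk M B = 4 := by omega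
    rw [this]; norm_num
  · have : crk M B = 4 := by omega
    rw [this]; norm_num
  · exfalso; omega
  · exfalso; omega
  · norm_num
  · norm_num

/-- A pair with two extra points is paid nothing when `ρ(E∖S) = 2` and `ρ(E∖B) ≤ 3`. -/
theorem wgn_eq_zero_of_sdiff_card_two_of_crk_eq_two_of_le_three {B S : Finset α} (he : (S \ B).card = 2)
    (hB2 : B.card = 2) (hr : crk M S = 2) (hp : crk M B ≤ 3) : wgn M B S = 0 := by
  by_cases hp3 : crk M B < 3
  · exact wgn_eq_zero_of_crk_lt_three hp3
  push Not at hp3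
  unfold wgn
  rw [wg_of_sdiff_card_two_of_card_two he hB2 hp3, hr, if_neg (by omega), if_neg (by omega), max_self]

/-- A pair with two extra points is paid at most `1/4` when `ρ(E∖S) ≥ 3`. -/
theorem wgn_le_quarter_of_sdiff_card_two_of_three_le_crk {B S : Finset α} (he : (S \ B).card = 2) (hB2 : B.card = 2)
    (hr : 3 ≤ crk M S) : wgn M B S ≤ 1 / 4 := by
  by_cases hp3 : crk M B < 3
  · rw [wgn_eq_zero_of_crk_lt_three hp3]; norm_num
  push Not at hp3
  unfold wgn
  rw [wg_of_sdiff_card_two_of_card_two he hB2 hp3]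
  apply max_le (by norm_num)
  have hp3q : (3 : ℚ) ≤ (crk M B : ℚ) := by exact_mod_cast hp3
  split_ifs with h1 h2 h3 h4 h5
  · have hp5 : (5 : ℚ) ≤ (crk M B : ℚ) := by exact_mod_cast (show 5 ≤ crk M B by omega)
    exact inv_sub_one_le_quarter hp5
  · have hp4 : (4 : ℚ) ≤ (crk M B : ℚ) := by exact_mod_cast h2.2
    exact two_div_le_quarter hp4
  · have hp4 : (4 : ℚ) ≤ (crk M B : ℚ) := by exact_mod_cast h2.2
    exact (inv_two_sub_le_sixth hp4).trans (by norm_num)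
  · exact (inv_three_sub_le_sixth hp3q).trans (by norm_num)
  · norm_num
  · norm_num

/-- A pair with two extra points and `j = 2` is paid at most `1/6` when `ρ(E∖S) ≥ 3`. -/
theorem wgn_le_sixth_of_sdiff_card_two_of_jB_two {B S : Finset α} (he : (S \ B).card = 2) (hB2 : B.card = 2)
    (hj : jB M B = 2) (_hr : 3 ≤ crk M S) : wgn M B S ≤ 1 / 6 := by
  by_cases hp3 : crk M B < 3
  · rw [wgn_eq_zero_of_crk_lt_three hp3]; norm_num
  push Not at hp3
  unfold wgn
  rw [wg_of_sdiff_card_two_of_card_two he hB2 hp3, if_neg (by rw [hj]; omega)]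
  apply max_le (by norm_num)
  have hp3q : (3 : ℚ) ≤ (crk M B : ℚ) := by exact_mod_cast hp3
  split_ifs with h2 h3 h4 h5
  · have hp5 : (5 : ℚ) ≤ (crk M B : ℚ) := by exact_mod_cast (show 5 ≤ crk M B by omega)
    exact two_div_le_sixth hp5
  · have hp4 : (4 : ℚ) ≤ (crk M B : ℚ) := by exact_mod_cast h2.2
    exact inv_two_sub_le_sixth hp4
  · exact inv_three_sub_le_sixth hp3q
  · norm_num
  · norm_num

/-- A pair with two extra points is paid at most `1/6` when `ρ(E∖S) ≥ 3` and `ρ(E∖B) ≤ ρ(E∖S) + 1`. -/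
theorem wgn_le_sixth_of_sdiff_card_two_of_crk_le {B S : Finset α} (he : (S \ B).card = 2) (hB2 : B.card = 2)
    (_hr : 3 ≤ crk M S) (hpr : crk M B ≤ crk M S + 1) : wgn M B S ≤ 1 / 6 := by
  by_cases hp3 : crk M B < 3
  · rw [wgn_eq_zero_of_crk_lt_three hp3]; norm_num
  push Not at hp3
  unfold wgn
  rw [wg_of_sdiff_card_two_of_card_two he hB2 hp3, if_neg (by omega)]
  apply max_le (by norm_num)
  have hp3q : (3 : ℚ) ≤ (crk M B : ℚ) := by exact_mod_cast hp3
  split_ifs with h2 h3 h4 h5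
  · exfalso; omega
  · have hp4 : (4 : ℚ) ≤ (crk M B : ℚ) := by exact_mod_cast h2.2
    exact inv_two_sub_le_sixth hp4
  · exact inv_three_sub_le_sixth hp3q
  · norm_num
  · norm_num

/-- A pair with two extra points, `ρ(E∖S) ≥ 3` and `ρ(E∖B) ≤ ρ(E∖S) + 1` is paid at most `1/(2r)`. -/
theorem wgn_le_inv_two_r_of_sdiff_card_two {B S : Finset α} (he : (S \ B).card = 2) (hB2 : B.card = 2)
    (hr : 3 ≤ crk M S) (hpr : crk M B ≤ crk M S + 1) : wgn M B S ≤ 1 / (2 * (crk M S : ℚ)) := by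
  have hrq : (3 : ℚ) ≤ (crk M S : ℚ) := by exact_mod_cast hr
  have hpos : (0 : ℚ) < 1 / (2 * (crk M S : ℚ)) := by positivity
  by_cases hp3 : crk M B < 3
  · rw [wgn_eq_zero_of_crk_lt_three hp3]; exact hpos.le
  push Not at hp3
  unfold wgn
  rw [wg_of_sdiff_card_two_of_card_two he hB2 hp3, if_neg (by omega)]
  apply max_le hpos.le
  split_ifs with h2 h3 h4 h5
  · exfalso; omega
  · have : (crk M B : ℚ) - 1 = (crk M S : ℚ) := by
      have : crk M B = crk M S + 1 := by omega
      rw [this]; push_cast; ring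
    rw [this]
  · have : (crk M B : ℚ) = (crk M S : ℚ) := by exact_mod_cast h5.symm
    rw [this, div_le_div_iff₀ (by linarith) (by linarith)]
    linarith
  · exact hpos.le
  · exact hpos.le

/-- A pair with two extra points, `ρ(E∖S) ≥ 3` and `ρ(E∖B) = ρ(E∖S)` is paid at most `1/(3(r−1))`. -/
theorem wgn_le_inv_three_of_sdiff_card_two_of_crk_eq {B S : Finset α} (he : (S \ B).card = 2) (hB2 : B.card = 2)
    (hr : 3 ≤ crk M S) (hpr : crk M B = crk M S) : wgn M B S ≤ 1 / (3 * ((crk M S : ℚ) - 1)) := by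
  have hrq : (3 : ℚ) ≤ (crk M S : ℚ) := by exact_mod_cast hr
  have hpos : (0 : ℚ) < 1 / (3 * ((crk M S : ℚ) - 1)) := by
    apply div_pos one_pos; linarith
  by_cases hp3 : crk M B < 3
  · rw [wgn_eq_zero_of_crk_lt_three hp3]; exact hpos.le
  push Not at hp3
  unfold wgn
  rw [wg_of_sdiff_card_two_of_card_two he hB2 hp3, if_neg (by omega)]
  apply max_le hpos.le
  split_ifs with h2 h3 h4 h5
  · exfalso; omega
  · exfalso; omega
  · rw [hpr]
  · exfalso; exact h5 hpr.symm
  · exact hpos.le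

/-- **The double count with the general rule**: if `wgn` satisfies (Cap) and (Dem) on `M` then `(Π_{2,3})` holds on
`M`. -/
theorem profileIneq_two_three_of_certG
    (hCap : ∀ S ∈ Shadow.levelSet M 3, ∑ B ∈ (Profile.Rq M 2).filter (fun B => B ⊆ S), wgn M B S ≤ 3)
    (hDem : ∀ B ∈ Profile.Rq M 2, 3 ≤ crk M B →
      (crk M B : ℚ) ≤ ∑ S ∈ (Shadow.levelSet M 3).filter (fun S => B ⊆ S), wgn M B S) :
    Profile.ProfileIneq M 2 3 := by
  unfold Profile.ProfileIneq
  have hswap : ∑ B ∈ Profile.Rq M 2, ∑ S ∈ (Shadow.levelSet M 3).filter (fun S => B ⊆ S), wgn M B S =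
      ∑ S ∈ Shadow.levelSet M 3, ∑ B ∈ (Profile.Rq M 2).filter (fun B => B ⊆ S), wgn M B S := by
    apply Finset.sum_comm'
    intro B S
    simp only [Finset.mem_filter]
    tauto
  have h1 : ∑ B ∈ Profile.Rq M 2, Profile.price M 2 3 B ≤
      ∑ B ∈ Profile.Rq M 2, (1 / 3 : ℚ) * ∑ S ∈ (Shadow.levelSet M 3).filter (fun S => B ⊆ S), wgn M B S := by
    apply Finset.sum_le_sum
    intro B hB
    rw [price_two_three_eq]
    split_ifs with h
    · have := hDem B hB h
      linarith
    · exact mul_nonneg (by norm_num) (Finset.sum_nonneg (fun S _ => wgn_nonneg B S))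
  have h2 : ∑ S ∈ Shadow.levelSet M 3, ∑ B ∈ (Profile.Rq M 2).filter (fun B => B ⊆ S), wgn M B S ≤
      ∑ _S ∈ Shadow.levelSet M 3, (3 : ℚ) := Finset.sum_le_sum hCap
  rw [Finset.sum_const, nsmul_eq_mul] at h2
  rw [← Finset.mul_sum, hswap] at h1
  linarith

end GenRule

end PercRepro
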